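import Literature.Analysis.FluidPDE.FluidComputer.GalerkinEnergyBalance
import Literature.Analysis.FluidPDE.FluidComputer.ShellTransferParseval
import HarnessLib

/-!
# Fluid computer — band sup amplitudes under an energy or analytic (Gevrey) envelope, on the lattice
(rung R3; the lattice face of idea-2's card O10 dictionary; pub-fluidc-lit gen 38)

HONEST FRAMING (cell `pub-fluidc`, verbatim): *low prior, high value-of-information experiment on Tao's
machine paradigm; NOT a claim that NS blows up.* Theorem side of the cell; nothing here is evidence of
blow-up and nothing about Navier–Stokes dynamics is asserted: the statements hold for EVERY field of
Fourier coefficients `û : ℤ³ → ℂ³` (tree: `ShellTransfer.FourierVelocity`) and every finite mode set `S`.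

The rung reads band sup amplitudes `U_B = sup_x |u_B(x)|` of sharp bands `B` of lattice modes (atlas key
`band_umax`).  Card O10 (idea-2; tree `FluidComputer/LambdaCeiling.lean`) argues under an ANALYTIC ENVELOPE
on block amplitudes, `‖Δ̇_j u‖_∞ ≤ M e^{-τ 2^j}`, whose printed backbone is a Gevrey-class norm bound
(Foias–Temam 1989; Cheng–Li–Xu 2017; cell file `LITERATURE.md` §A22.13) and whose dictionary
"Gevrey norm ⇒ block envelope (polynomial prefactors absorbed)" LambdaCeiling leaves informal.  On the
lattice that dictionary is two lines of Cauchy–Schwarz, typed here for the cell's own trigonometric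
fields `field U S j` (tree: `ShellTransfer.field`, `u_{S,j}(x) = Σ_{k∈S} û_j(k) e^{ik·x}`):

* `norm_field_le_sum_norm` — `|u_{S,j}(x)| ≤ Σ_{k∈S} |û_j(k)|` (`|e^{ik·x}| = 1`, `norm_wave`);
* `norm_field_le_sqrt_card_mul` — **lattice Bernstein**: `|u_{S,j}(x)| ≤ √|S| · (Σ_{k∈S} |û_j(k)|²)^{1/2}`,
  hence `norm_field_le_sqrt_card_energy`: `|u_{S,j}(x)| ≤ √|S| · √(2 E_S)` with the tree's truncated
  energy `E_S = ½ Σ_{k∈S} |û(k)|²` (`ShellTransfer.truncEnergy`) — the band sup is capped by the band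
  ENERGY times the square root of the number of modes (the continuum twin, `U_q ≤ C 2^{3q/2} ‖u‖₂` for
  Littlewood–Paley blocks on `ℝ³`, is `LevelOccupationFloor.exists_blockSup_le_energy`);
* `norm_field_le_weighted` — the weighted Cauchy–Schwarz `|u_{S,j}(x)| ≤ (Σ w⁻²)^{1/2} (Σ w²|û_j|²)^{1/2}`
  for any nonvanishing weight `w` on `S`;
* `norm_field_le_gevrey_envelope` — **the analytic envelope**: if `σ ≥ 0` and `k_lo ≤ |k|` on `S` then
  `|u_{S,j}(x)| ≤ √|S| · e^{-σ k_lo} · (Σ_{k∈S} e^{2σ|k|} |û_j(k)|²)^{1/2}`, i.e. a Gevrey-`σ` (Foias–Temam)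
  norm bound `G` gives the band envelope `U_B ≤ √|B| · G · e^{-σ k_lo(B)}` — exponential in the band's
  lower edge with the polynomial prefactor `√|B|` explicit (for the rung's octave bands `|B| ∝ k_lo³`).

All proved, 0 sorry, no new definitions or named facts (D-0026).  References: C. Foias, R. Temam,
J. Funct. Anal. 87 (1989) 359–369 (the Gevrey norm `|e^{σA^{1/2}}u|`); the Bernstein / Nikol'skii
inequality for trigonometric polynomials is classical.
-/

noncomputable section

namespace Summit.NavierStokesRegularity.FluidComputer.BandSupEnvelope

open Complex Finset Real
open scoped BigOperators
open Literature.Analysis.FluidPDE.FluidComputer Literature.Analysis.FluidPDE.FluidComputer.ShellTransfer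

variable (U : FourierVelocity)

/-! ## Unimodular plane waves -/

/-- `|e^{int}| = 1`. -/
theorem norm_mode (n : ℤ) (t : ℝ) : ‖mode n t‖ = 1 := by
  rw [mode, Complex.norm_exp]
  simp

/-- `|e^{ik·x}| = 1`. -/
theorem norm_wave (m : Fin 3 → ℤ) (x y z : ℝ) : ‖wave m x y z‖ = 1 := by
  rw [wave, norm_mul, norm_mul, norm_mode, norm_mode, norm_mode, mul_one, mul_one]

/-! ## Triangle inequality and Cauchy–Schwarz -/

/-- `|u_{S,j}(x)| ≤ Σ_{k∈S} |û_j(k)|`. -/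
theorem norm_field_le_sum_norm (S : Finset (Fin 3 → ℤ)) (j : Fin 3) (x y z : ℝ) :
    ‖field U S j x y z‖ ≤ ∑ k ∈ S, ‖U.coeff k j‖ := by
  unfold field
  refine (norm_sum_le _ _).trans (le_of_eq (Finset.sum_congr rfl fun k _ => ?_))
  rw [norm_mul, norm_wave, mul_one]

/-- Discrete Cauchy–Schwarz: `Σ aᵢbᵢ ≤ √(Σ aᵢ²) √(Σ bᵢ²)`. -/
private theorem sum_mul_le_sqrt_mul_sqrt {ι : Type*} (s : Finset ι) (a b : ι → ℝ) :
    ∑ i ∈ s, a i * b i ≤ Real.sqrt (∑ i ∈ s, a i ^ 2) * Real.sqrt (∑ i ∈ s, b i ^ 2) := by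
  have h := Finset.sum_mul_sq_le_sq_mul_sq s a b
  have ha : 0 ≤ ∑ i ∈ s, a i ^ 2 := Finset.sum_nonneg fun i _ => sq_nonneg _
  rw [← Real.sqrt_mul ha]
  calc ∑ i ∈ s, a i * b i ≤ |∑ i ∈ s, a i * b i| := le_abs_self _
    _ = Real.sqrt ((∑ i ∈ s, a i * b i) ^ 2) := (Real.sqrt_sq_eq_abs _).symm
    _ ≤ Real.sqrt ((∑ i ∈ s, a i ^ 2) * ∑ i ∈ s, b i ^ 2) := Real.sqrt_le_sqrt h

/-- **Lattice Bernstein inequality**: `|u_{S,j}(x)| ≤ √|S| · (Σ_{k∈S} |û_j(k)|²)^{1/2}`. -/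
theorem norm_field_le_sqrt_card_mul (S : Finset (Fin 3 → ℤ)) (j : Fin 3) (x y z : ℝ) :
    ‖field U S j x y z‖ ≤ Real.sqrt S.card * Real.sqrt (∑ k ∈ S, ‖U.coeff k j‖ ^ 2) := by
  refine (norm_field_le_sum_norm U S j x y z).trans ?_
  have h := sum_mul_le_sqrt_mul_sqrt S (fun _ => (1 : ℝ)) (fun k => ‖U.coeff k j‖)
  simpa only [one_mul, one_pow, Finset.sum_const, nsmul_eq_mul, mul_one] using h

/-- One component's squared coefficient is at most twice the modal energy `E(k) = ½ Σ_j |û_j(k)|²`. -/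
theorem norm_sq_coeff_le_two_mul_modalEnergy (k : Fin 3 → ℤ) (j : Fin 3) :
    ‖U.coeff k j‖ ^ 2 ≤ 2 * modalEnergy U k := by
  unfold modalEnergy
  rw [← mul_assoc, (by norm_num : (2 : ℝ) * (1 / 2) = 1), one_mul, ← Complex.normSq_eq_norm_sq]
  exact Finset.single_le_sum (f := fun i => Complex.normSq (U.coeff k i))
    (fun i _ => Complex.normSq_nonneg _) (Finset.mem_univ j)

/-- **Band sup under the band energy**: `|u_{S,j}(x)| ≤ √|S| · √(2 E_S)` — the sup amplitude of a band is
at most the square root of (number of modes × twice the band energy). -/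
theorem norm_field_le_sqrt_card_energy (S : Finset (Fin 3 → ℤ)) (j : Fin 3) (x y z : ℝ) :
    ‖field U S j x y z‖ ≤ Real.sqrt S.card * Real.sqrt (2 * truncEnergy U S) := by
  refine (norm_field_le_sqrt_card_mul U S j x y z).trans
    (mul_le_mul_of_nonneg_left (Real.sqrt_le_sqrt ?_) (Real.sqrt_nonneg _))
  rw [truncEnergy, Finset.mul_sum]
  exact Finset.sum_le_sum fun k _ => norm_sq_coeff_le_two_mul_modalEnergy U k j

/-- **Weighted Cauchy–Schwarz**: for a nonvanishing weight `w` on `S`,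
`|u_{S,j}(x)| ≤ (Σ_{k∈S} w(k)⁻²)^{1/2} (Σ_{k∈S} (w(k)|û_j(k)|)²)^{1/2}`. -/
theorem norm_field_le_weighted (S : Finset (Fin 3 → ℤ)) (j : Fin 3) (x y z : ℝ)
    (w : (Fin 3 → ℤ) → ℝ) (hw : ∀ k ∈ S, w k ≠ 0) :
    ‖field U S j x y z‖ ≤
      Real.sqrt (∑ k ∈ S, (w k)⁻¹ ^ 2) * Real.sqrt (∑ k ∈ S, (w k * ‖U.coeff k j‖) ^ 2) := by
  refine (norm_field_le_sum_norm U S j x y z).trans ?_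
  have h := sum_mul_le_sqrt_mul_sqrt S (fun k => (w k)⁻¹) (fun k => w k * ‖U.coeff k j‖)
  refine le_trans (le_of_eq (Finset.sum_congr rfl fun k hk => ?_)) h
  rw [← mul_assoc, inv_mul_cancel₀ (hw k hk), one_mul]

/-- **The analytic (Gevrey) envelope on the lattice.**  If `σ ≥ 0` and every mode of `S` has
`k_lo ≤ |k|`, then `|u_{S,j}(x)| ≤ √|S| · e^{-σ k_lo} · (Σ_{k∈S} e^{2σ|k|} |û_j(k)|²)^{1/2}`: a bound `G` on
the Gevrey-`σ` sum caps the band sup by `√|S| · G · e^{-σ k_lo}` — exponentially small in the band's lower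
edge, with the polynomial prefactor `√|S|` explicit.  This is the lattice form of the dictionary
"analytic norm ⇒ block envelope" that `LambdaCeiling` assumes informally. -/
theorem norm_field_le_gevrey_envelope (S : Finset (Fin 3 → ℤ)) (j : Fin 3) (x y z : ℝ) {σ klo : ℝ}
    (hσ : 0 ≤ σ) (hS : ∀ k ∈ S, klo ≤ Real.sqrt (knormSq k)) :
    ‖field U S j x y z‖ ≤ Real.sqrt S.card * Real.exp (-(σ * klo)) *
      Real.sqrt (∑ k ∈ S, Real.exp (2 * σ * Real.sqrt (knormSq k)) * ‖U.coeff k j‖ ^ 2) := by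
  have h := norm_field_le_weighted U S j x y z (fun k => Real.exp (σ * Real.sqrt (knormSq k)))
    (fun k _ => (Real.exp_pos _).ne')
  -- the first factor: `Σ e^{-2σ|k|} ≤ |S| e^{-2σ k_lo}`
  have h1 : Real.sqrt (∑ k ∈ S, (Real.exp (σ * Real.sqrt (knormSq k)))⁻¹ ^ 2) ≤
      Real.sqrt S.card * Real.exp (-(σ * klo)) := by
    have hle : ∑ k ∈ S, (Real.exp (σ * Real.sqrt (knormSq k)))⁻¹ ^ 2 ≤
        ∑ k ∈ S, Real.exp (-(σ * klo)) ^ 2 := by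
      refine Finset.sum_le_sum fun k hk => ?_
      rw [← Real.exp_neg]
      exact pow_le_pow_left₀ (Real.exp_pos _).le
        (Real.exp_le_exp.2 (neg_le_neg (mul_le_mul_of_nonneg_left (hS k hk) hσ))) 2
    calc Real.sqrt (∑ k ∈ S, (Real.exp (σ * Real.sqrt (knormSq k)))⁻¹ ^ 2)
        ≤ Real.sqrt (∑ k ∈ S, Real.exp (-(σ * klo)) ^ 2) := Real.sqrt_le_sqrt hle
      _ = Real.sqrt S.card * Real.exp (-(σ * klo)) := by
          rw [Finset.sum_const, nsmul_eq_mul, Real.sqrt_mul (Nat.cast_nonneg _),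
            Real.sqrt_sq (Real.exp_pos _).le]
  -- the second factor is the Gevrey sum
  have h2 : ∀ k ∈ S, (Real.exp (σ * Real.sqrt (knormSq k)) * ‖U.coeff k j‖) ^ 2 =
      Real.exp (2 * σ * Real.sqrt (knormSq k)) * ‖U.coeff k j‖ ^ 2 := fun k _ => by
    rw [mul_pow, pow_two (Real.exp _), ← Real.exp_add]
    congr 2
    ring
  rw [Finset.sum_congr rfl h2] at h
  exact h.trans (mul_le_mul_of_nonneg_right h1 (Real.sqrt_nonneg _))

end Summit.NavierStokesRegularity.FluidComputer.BandSupEnvelope
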